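import Literature.AlgebraicGeometry.HodgeTheory.QuaternionicQuarticFamily
import Literature.AlgebraicGeometry.HodgeTheory.QuaternionicQuarticDeckChartAction
import Mathlib.CategoryTheory.Monoidal.Cartesian.Over
import HarnessLib

/-!
# «M1»: the deck pair `(τ, j)` as automorphisms of a smooth projective FAMILY model of the quaternionic quartic
# multiple planes — the statement `Q8FamilyDeck`

Layer `Literature/AlgebraicGeometry/HodgeTheory`; STATEMENT file (definitions only, no named fact, nothing proved).
Written by the prover seat `hodge-nonav-prover-Bx` (g19, cell `hodge-nonav`), programme M1 (memo
`PROGRAMME-M1-Bx-g19.md`; p3 g36 2026-08-29T08:41:37Z, 10:40:10Z, 11:26:56Z) for route `HodgeConjecture/Q8SymplecticPowers`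
(crux K1Q, stmt-HodgeConjecture-24190; it is, verbatim, the body of the registered stub `stub_familyDeckExistsQ` (S6) of the
K1Q skeleton `mechanism-v2`). Companion of `Q8Family.QFamily` (QF-0): the same kind of family (a smooth projective family of
surfaces over a non-empty open of the parameter space `𝔸^{CIdx e}`, quasi-projective total space, smooth quasi-projective base),
now CARRYING THE DECK PAIR:

* (iv) two automorphisms `τ, j` of the total space over the base with the quaternion relations `τ⁴ = 1`, `j² = τ²`, `τ j τ = j`;
* (v) an OPEN IMMERSION over the base of the explicit étale chart `𝒰 ×_A W` of the normalised quartic cover (`Q8Family.deckChart`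
  of the tautological coefficient vector, coordinates `u₀, u₁, w, w₁, w₂, v` with the seven relations of
  `QuaternionicQuarticDeckChart`) intertwining `(τ, j)` with the base change of the EXPLICIT pair `(τ₀, j₀) = (ρ(a 1), ρ(xa 0))` of
  `Q8Family.deckAction` (signed permutations of the coordinates: `τ₀ = (u₀, u₁, i w, −w₁, −i w₂, v)`,
  `j₀ = (u₁, u₀, w₂, −w₁, −w, −v)`);
* (vi) whose image meets every fibre (the fibres being irreducible, it is fibrewise dense).

So on every fibre the pair is conjugate, on a dense open with explicit coordinates, to the route's deck transformations — in
particular `τ² ≠ 1` on every fibre (`w ↦ −w`) — and the cohomological clauses of the leaf (brick M1-d, stubs S4/S5/S7 of the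
skeleton) are computed from explicit equations. The fibrewise birationality to the hypersurfaces `V_(c,ψ)` (clause (iii) of
`QFamily`) is NOT part of this statement (p3 10:40:10Z): it follows from (v)–(vi) and the chart-in-cover theorem
`Q8Family.exists_chartEmb` (M1-1, 19716-p2 g13) and is recorded separately as `Q8FamilyDeck_birational`.

Honest scope: a statement; nothing is proved here and nothing here bears on HC.

## References

* [Kollar2007] J. Kollár, Lectures on Resolution of Singularities (2007), Thm. 3.36, §3.4.1 (the one named fact of the
  programme, used by the proof `q8FamilyDeck_holds`, not here).
* [EGAIV3] A. Grothendieck, J. Dieudonné, EGA IV₃ (1966), §8.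
-/

noncomputable section

open CategoryTheory CategoryTheory.Limits AlgebraicGeometry MvPolynomial MonoidalCategory CartesianMonoidalCategory
open Literature.AlgebraicGeometry.Motives Literature.AlgebraicGeometry.RelativeSpec

namespace Literature.AlgebraicGeometry.HodgeTheory.Q8Family

/-- **«Q-FAMILY WITH DECK PAIR»** (programme M1 = stub S6 `stub_familyDeckExistsQ` of the K1Q skeleton `mechanism-v2`, verbatim;
to be discharged as `q8FamilyDeck_holds`, NOT proved here): over a NON-EMPTY Zariski-open `W` of the parameter space `𝔸^{CIdx e}`
there is a smooth projective family `π : 𝒳 → W` of relative dimension `2`, with `𝒳` and `W` quasi-projective and `W` smooth,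
carrying (iv) `W`-automorphisms `τ, j` with `τ⁴ = 1`, `j² = τ²`, `τ j τ = j`, (v) an open immersion over `W` of the explicit étale
chart `𝒰 ×_A W` (`𝒰 = deckChart (X ·)`) intertwining `(τ, j)` with the base change `ρ(g) ▷ W` of the explicit pair
`(ρ(a 1), ρ(xa 0))`, `ρ = deckAction (X ·)`, and (vi) meeting every fibre of `π`.
[cite: Kollar2007, Thm. 3.36 and §3.4.1] [cite: EGAIV3, §8.10.5] -/
def Q8FamilyDeck (e : ℕ) : Prop :=
  ∃ (W : (Spec (.of (ParamRing e))).Opens) (𝒳 : SchemeOver ℂ) (π : 𝒳 ⟶ base W) (τ j : 𝒳 ⟶ 𝒳)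
    (ι : (deckChart (fun i => (MvPolynomial.X i : ParamRing e)) ⊗ Over.mk W.ι).left ⟶ 𝒳.left),
    Nonempty (ComplexPoints (base W)) ∧ IsSmoothProjectiveFamily π 2 ∧ IsQuasiProjectiveOver 𝒳 ∧
    IsQuasiProjectiveOver (base W) ∧ AlgebraicGeometry.SmoothOfRelativeDimension (Fintype.card (CIdx e)) (base W).hom ∧
    (τ ≫ π = π ∧ j ≫ π = π ∧ τ ≫ τ ≫ τ ≫ τ = 𝟙 𝒳 ∧ j ≫ j = τ ≫ τ ∧ τ ≫ j ≫ τ = j) ∧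
    IsOpenImmersion ι ∧ ι ≫ π.left = (snd (deckChart (fun i => (MvPolynomial.X i : ParamRing e))) (Over.mk W.ι)).left ∧
    ((Over.isoMk ((deckAction (fun i => (MvPolynomial.X i : ParamRing e))).aut (QuaternionGroup.a 1))
        ((deckAction (fun i => (MvPolynomial.X i : ParamRing e))).aut_comp (QuaternionGroup.a 1))).hom ▷
          Over.mk W.ι).left ≫ ι = ι ≫ τ.left ∧
    ((Over.isoMk ((deckAction (fun i => (MvPolynomial.X i : ParamRing e))).aut (QuaternionGroup.xa 0))
        ((deckAction (fun i => (MvPolynomial.X i : ParamRing e))).aut_comp (QuaternionGroup.xa 0))).hom ▷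
          Over.mk W.ι).left ≫ ι = ι ≫ j.left ∧
    Function.Surjective (snd (deckChart (fun i => (MvPolynomial.X i : ParamRing e))) (Over.mk W.ι)).left

end Literature.AlgebraicGeometry.HodgeTheory.Q8Family

end
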